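import Literature.Topology.FourManifolds.SphereInversion
import Literature.Topology.FourManifolds.SpikeModel
import Literature.Topology.FourManifolds.BandSumSymmetry
import Literature.Topology.FourManifolds.BandSumProofs
import HarnessLib

/-!
# Transported band-sum data: the half-turned band reflected to the north

Topic `Literature/Topology/FourManifolds` (trunk T-4MAN). Fact seat
`provefact-Literature.Topology.FourManifolds.Knot.IsConnectedSum.isIsotopic` (Schubert's theorem),
geometric heart for rail knots, transport step. For band-sum data `b` of `(A, B, K)` with `A`
north and `B` south, the half-turned band (tree: `BandData.halfTurn`, `BandSumSymmetry.lean`)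
carried by the reflection `R = reflectLast 3` (tree: `BandData.exists_map`, `BandSumProofs.lean`)
is band-sum data `b̃` of `(B.map R, A.map R, K.map R)` — again "first summand north, second
south" — with `b̃.band x = R (b.band ((1, 1) - x))` and the same collar width
(`BandData.IsTransport`, `exists_isTransport`). This file relates the crossing data of `b̃` to
those of `b` (`CrossingFrame.lean`):

* the normal-position hypothesis transports (`IsTransport.cross_eq`);
* in the chart, `b̃.Fband q = sphereInv (b.Fband (-q))` near `0` (`SphereInversion.lean`), so the
  crossing points read in the chart coincide (`pZero_eq`), and the frame vectors are
  `f̃ᵢ = -Ref fᵢ` with `Ref = D sphereInv (pZero)` the reflection in `pZero^⊥`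
  (`fZero_eq`, `fOne_eq`), while the third frame vector is a nonzero multiple of `Ref g₂`
  (`exists_gTwo_eq`): hence `Ref (frame Z) = framẽ (-Z₀, -Z₁, μ Z₂)` (`refl_frame`), i.e. to
  first order the blow-up coordinates of `b̃` at a reflected point are those of `b` with the
  first two coordinates negated.

Everything is proved; no named facts are introduced.

## References

* J. M. Lee, *Introduction to Smooth Manifolds*, 2nd ed. (2012), Problem 1-7. [LeeSmoothManifolds2013]
-/

open scoped Manifold ContDiff Topology Real RealInnerProductSpace Matrix
open Function Set Metric Filter

noncomputable section

namespace Literature.Topology.FourManifolds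

/-- Local notation: `𝔼 n` is the model Euclidean space `EuclideanSpace ℝ (Fin n)`. -/
local notation "𝔼 " n:arg => EuclideanSpace ℝ (Fin n)

/-- Local notation: `𝕊 n` is the unit sphere in `EuclideanSpace ℝ (Fin (n + 1))`. -/
local notation "𝕊 " n:arg => (Metric.sphere (0 : EuclideanSpace ℝ (Fin (n + 1))) 1)

attribute [local instance] fact_finrank_euclideanSpace_succ

open KnotsInBall

/-! ### The reflection in the hyperplane orthogonal to a point of the sphere of radius `2` -/

/-- **The linear reflection** `Ref_p h = h - (⟪p, h⟫/2) p` (the derivative of `sphereInv` at `p`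
when `‖p‖ = 2`). [folklore] -/
def refl (p : 𝔼 3) : (𝔼 3) →L[ℝ] 𝔼 3 :=
  ContinuousLinearMap.id ℝ (𝔼 3) - (1 / 2 : ℝ) • ((innerSL ℝ p).smulRight p)

/-- The reflection as a formula. [folklore] -/
theorem refl_apply (p h : 𝔼 3) : refl p h = h - (⟪p, h⟫ / 2) • p := by
  simp [refl, ContinuousLinearMap.smulRight_apply, smul_smul]
  ring_nf

/-- The reflection negates `p` (`‖p‖ = 2`). [folklore] -/
theorem refl_self {p : 𝔼 3} (hp : ‖p‖ = 2) : refl p p = -p := by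
  rw [refl_apply, real_inner_self_eq_norm_sq, hp]; norm_num; module

/-- The reflection is an involution (`‖p‖ = 2`). [folklore] -/
theorem refl_refl {p : 𝔼 3} (hp : ‖p‖ = 2) (h : 𝔼 3) : refl p (refl p h) = h := by
  rw [refl_apply, refl_apply, inner_sub_right, inner_smul_right, real_inner_self_eq_norm_sq, hp]
  norm_num
  module

/-- The reflection preserves inner products (`‖p‖ = 2`). [folklore] -/
theorem inner_refl_refl {p : 𝔼 3} (hp : ‖p‖ = 2) (u v : 𝔼 3) : ⟪refl p u, refl p v⟫ = ⟪u, v⟫ := by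
  rw [refl_apply, refl_apply, inner_sub_left, inner_sub_right, inner_sub_right, inner_smul_left, inner_smul_right,
    inner_smul_left, inner_smul_right, real_inner_self_eq_norm_sq, hp, real_inner_comm p u]
  simp only [conj_trivial]
  ring

/-- The reflection is injective (`‖p‖ = 2`). [folklore] -/
theorem refl_injective {p : 𝔼 3} (hp : ‖p‖ = 2) : Injective (refl p) := fun u v h ↦ by
  rw [← refl_refl hp u, ← refl_refl hp v, h]

/-- The derivative of the inversion at `p` (`‖p‖ = 2`) is the reflection. [folklore] -/
theorem hasFDerivAt_sphereInv_refl {p : 𝔼 3} (hp : ‖p‖ = 2) : HasFDerivAt sphereInv (refl p) p :=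
  hasFDerivAt_sphereInv_of_norm_eq_two hp

namespace BandData

variable {A B K : Knot} (b : BandData A B K ∅)

/-! ### Transported data -/

/-- **Transported band-sum data**: `b̃.band x = R (b.band ((1, 1) - x))` and the same collar
width. [folklore] -/
structure IsTransport (bt : BandData (B.map (reflectLastDiffeo 3)) (A.map (reflectLastDiffeo 3)) (K.map (reflectLastDiffeo 3)) ∅) :
    Prop where
  band_eq : ∀ x, bt.band x = reflectLast 3 (b.band (pt2 1 1 - x))
  δ_eq : bt.δ = b.δ

/-- **Transported data exist** (half-turn, then transport along the reflection). [folklore] -/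
theorem exists_isTransport (hAB : Disjoint (range A) (range B)) :
    ∃ bt : BandData (B.map (reflectLastDiffeo 3)) (A.map (reflectLastDiffeo 3)) (K.map (reflectLastDiffeo 3)) ∅, b.IsTransport bt := by
  obtain ⟨bt, hband, hδ⟩ := (b.halfTurn hAB).exists_map (reflectLastDiffeo 3)
  exact ⟨bt, ⟨fun x ↦ by rw [hband, comp_apply, halfTurn_band, coe_reflectLastDiffeo], by rw [hδ, halfTurn_δ]⟩⟩

namespace IsTransport

variable {b} {bt : BandData (B.map (reflectLastDiffeo 3)) (A.map (reflectLastDiffeo 3)) (K.map (reflectLastDiffeo 3)) ∅}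
  (ht : b.IsTransport bt)
include ht

/-- The square neighbourhood is symmetric under the half-turn. [folklore] -/
theorem sub_mem_squareNhd_iff (x : 𝔼 2) : pt2 1 1 - x ∈ squareNhd b.δ ↔ x ∈ squareNhd bt.δ := by
  rw [mem_squareNhd_iff, mem_squareNhd_iff, ht.δ_eq]
  refine forall_congr' fun i ↦ ?_
  have : (pt2 1 1 - x) i = 1 - x i := by fin_cases i <;> simp
  rw [this]
  constructor <;> rintro ⟨h1, h2⟩ <;> constructor <;> linarith

/-- **The normal-position hypothesis transports.** [folklore] -/
theorem cross_eq (hcross : b.band ⁻¹' sphereEquator 2 ∩ squareNhd b.δ = {x ∈ squareNhd b.δ | x 0 = 2⁻¹}) :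
    bt.band ⁻¹' sphereEquator 2 ∩ squareNhd bt.δ = {x ∈ squareNhd bt.δ | x 0 = 2⁻¹} := by
  ext x
  have hx' := ht.sub_mem_squareNhd_iff x
  have key : pt2 1 1 - x ∈ b.band ⁻¹' sphereEquator 2 ∩ squareNhd b.δ ↔ pt2 1 1 - x ∈ {x ∈ squareNhd b.δ | x 0 = 2⁻¹} := by
    rw [hcross]
  simp only [mem_inter_iff, mem_preimage, mem_setOf_eq] at key ⊢
  rw [ht.band_eq, reflectLast_mem_sphereEquator_iff]
  have h0 : (pt2 1 1 - x) 0 = 1 - x 0 := by simp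
  rw [h0, hx'] at key
  constructor
  · rintro ⟨h1, h2⟩; exact ⟨h2, by linarith [(key.1 ⟨h1, h2⟩).2]⟩
  · rintro ⟨h1, h2⟩; exact ⟨(key.2 ⟨h1, by linarith⟩).1, h1⟩

/-- **The band in the chart**: `b̃.Fband q = sphereInv (b.Fband (-q))` near `0`. [folklore] -/
theorem Fband_eq {hcross : b.band ⁻¹' sphereEquator 2 ∩ squareNhd b.δ = {x ∈ squareNhd b.δ | x 0 = 2⁻¹}}
    {hcrosst : bt.band ⁻¹' sphereEquator 2 ∩ squareNhd bt.δ = {x ∈ squareNhd bt.δ | x 0 = 2⁻¹}} {q : 𝔼 2}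
    (hq : ‖q‖ < b.poleRad hcross) (hqt : ‖q‖ < bt.poleRad hcrosst) : bt.Fband q = sphereInv (b.Fband (-q)) := by
  have e : pt2 1 1 - (pt2 2⁻¹ 2⁻¹ + q) = pt2 2⁻¹ 2⁻¹ + -q := by
    ext i; fin_cases i <;> simp <;> ring
  have hN : b.band (pt2 2⁻¹ 2⁻¹ + -q) ≠ northPole := b.band_ne_northPole_of_norm_lt hcross (by rwa [norm_neg])
  have hS : reflectLast 3 (b.band (pt2 2⁻¹ 2⁻¹ + -q)) ≠ northPole := by
    rw [← e, ← ht.band_eq]; exact bt.band_ne_northPole_of_norm_lt hcrosst hqt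
  rw [Fband, ht.band_eq, e, psiN_reflectLast hN hS, Fband]

/-- **The crossing points agree in the chart.** [folklore] -/
theorem pZero_eq {hcross : b.band ⁻¹' sphereEquator 2 ∩ squareNhd b.δ = {x ∈ squareNhd b.δ | x 0 = 2⁻¹}}
    {hcrosst : bt.band ⁻¹' sphereEquator 2 ∩ squareNhd bt.δ = {x ∈ squareNhd bt.δ | x 0 = 2⁻¹}} : bt.pZero = b.pZero := by
  have h := ht.Fband_eq (hcross := hcross) (hcrosst := hcrosst) (q := 0) (by rw [norm_zero]; exact (b.poleRad_pos hcross).1)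
    (by rw [norm_zero]; exact (bt.poleRad_pos hcrosst).1)
  rw [neg_zero] at h
  rw [pZero, h, ← pZero, sphereInv_of_norm_eq_two (b.norm_pZero hcross)]

/-- **The derivative of the band in the chart**: `D F̃ (0) = Ref ∘ D F (0) ∘ (-id)`. [folklore] -/
theorem fderiv_Fband_eq (hcross : b.band ⁻¹' sphereEquator 2 ∩ squareNhd b.δ = {x ∈ squareNhd b.δ | x 0 = 2⁻¹})
    (hcrosst : bt.band ⁻¹' sphereEquator 2 ∩ squareNhd bt.δ = {x ∈ squareNhd bt.δ | x 0 = 2⁻¹}) :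
    fderiv ℝ bt.Fband 0 = (refl b.pZero).comp ((fderiv ℝ b.Fband 0).comp (-ContinuousLinearMap.id ℝ (𝔼 2))) := by
  have hr : 0 < min (b.poleRad hcross) (bt.poleRad hcrosst) := lt_min (b.poleRad_pos hcross).1 (bt.poleRad_pos hcrosst).1
  have hev : bt.Fband =ᶠ[𝓝 0] fun q ↦ sphereInv (b.Fband (-q)) := by
    filter_upwards [Metric.ball_mem_nhds (0 : 𝔼 2) hr] with q hq
    rw [mem_ball, dist_zero_right, lt_min_iff] at hq
    exact ht.Fband_eq hq.1 hq.2
  have h1 : HasFDerivAt (fun q : 𝔼 2 ↦ -q) (-ContinuousLinearMap.id ℝ (𝔼 2)) 0 := (hasFDerivAt_id 0).neg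
  have h2 : HasFDerivAt b.Fband (fderiv ℝ b.Fband 0) (-0) := by
    rw [neg_zero]; exact (b.differentiableAt_Fband hcross (by rw [norm_zero]; exact (b.poleRad_pos hcross).1)).hasFDerivAt
  have h3 : HasFDerivAt sphereInv (refl b.pZero) (b.Fband (-0)) := by
    rw [neg_zero]; exact hasFDerivAt_sphereInv_refl (b.norm_pZero hcross)
  exact ((h3.comp 0 (h2.comp 0 h1)).congr_of_eventuallyEq hev).fderiv

/-- **First frame vector**: `f̃₀ = -Ref f₀`. [folklore] -/
theorem fZero_eq (hcross : b.band ⁻¹' sphereEquator 2 ∩ squareNhd b.δ = {x ∈ squareNhd b.δ | x 0 = 2⁻¹})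
    (hcrosst : bt.band ⁻¹' sphereEquator 2 ∩ squareNhd bt.δ = {x ∈ squareNhd bt.δ | x 0 = 2⁻¹}) :
    bt.fZero = -refl b.pZero b.fZero := by
  rw [fZero, ht.fderiv_Fband_eq hcross hcrosst, fZero]
  simp

/-- **Second frame vector**: `f̃₁ = -Ref f₁`. [folklore] -/
theorem fOne_eq (hcross : b.band ⁻¹' sphereEquator 2 ∩ squareNhd b.δ = {x ∈ squareNhd b.δ | x 0 = 2⁻¹})
    (hcrosst : bt.band ⁻¹' sphereEquator 2 ∩ squareNhd bt.δ = {x ∈ squareNhd bt.δ | x 0 = 2⁻¹}) :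
    bt.fOne = -refl b.pZero b.fOne := by
  rw [fOne, ht.fderiv_Fband_eq hcross hcrosst, fOne]
  simp

/-! ### The third frame vector and the frame relation -/

omit ht in
/-- The third frame vector is orthogonal to the first. [folklore] -/
theorem inner_gTwo_fZero (b' : BandData A B K ∅) : ⟪b'.gTwo, b'.fZero⟫ = 0 := by
  rw [EuclideanSpace.inner_eq_star_dotProduct, gTwo, star_trivial, WithLp.ofLp_toLp]
  exact dot_self_cross (vec3 b'.fZero) (vec3 b'.fOne)

omit ht in
/-- The third frame vector is orthogonal to the second. [folklore] -/
theorem inner_gTwo_fOne (b' : BandData A B K ∅) : ⟪b'.gTwo, b'.fOne⟫ = 0 := by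
  rw [EuclideanSpace.inner_eq_star_dotProduct, gTwo, star_trivial, WithLp.ofLp_toLp]
  exact dot_cross_self (vec3 b'.fZero) (vec3 b'.fOne)

omit ht in
/-- In `ℝ³` a vector orthogonal to `u` and `v` is a multiple of `u × v` when `u × v ≠ 0`. [folklore] -/
theorem exists_eq_smul_cross {u v w : Fin 3 → ℝ} (hne : u ⨯₃ v ≠ 0) (hu : u ⬝ᵥ w = 0) (hv : v ⬝ᵥ w = 0) :
    ∃ μ : ℝ, w = μ • (u ⨯₃ v) := by
  have h0 : (u ⨯₃ v) ⨯₃ w = 0 := by rw [cross_cross_eq_smul_sub_smul, hu, hv, zero_smul, zero_smul, sub_zero]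
  have hdep : ¬ LinearIndependent ℝ ![u ⨯₃ v, w] := fun h ↦ (crossProduct_ne_zero_iff_linearIndependent.2 h) h0
  rw [LinearIndependent.pair_iff] at hdep
  push Not at hdep
  obtain ⟨s, t, hst, hst0⟩ := hdep
  by_cases ht0 : t = 0
  · subst ht0
    rw [zero_smul, add_zero] at hst
    rcases smul_eq_zero.1 hst with hs | hs
    · exact absurd hs (fun hs ↦ hst0 hs rfl)
    · exact absurd hs hne
  · refine ⟨-(s / t), ?_⟩
    have : t • w = -(s • (u ⨯₃ v)) := eq_neg_of_add_eq_zero_right hst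
    calc w = t⁻¹ • (t • w) := by rw [smul_smul, inv_mul_cancel₀ ht0, one_smul]
      _ = -(s / t) • (u ⨯₃ v) := by rw [this, smul_neg, smul_smul, neg_smul, div_eq_inv_mul]


section Frame

variable (hcross : b.band ⁻¹' sphereEquator 2 ∩ squareNhd b.δ = {x ∈ squareNhd b.δ | x 0 = 2⁻¹})
  (hcrosst : bt.band ⁻¹' sphereEquator 2 ∩ squareNhd bt.δ = {x ∈ squareNhd bt.δ | x 0 = 2⁻¹})
include hcross hcrosst

/-- **The reflected third frame vector is a nonzero multiple of the transported one.** [folklore] -/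
theorem exists_refl_gTwo : ∃ μ : ℝ, μ ≠ 0 ∧ refl b.pZero b.gTwo = μ • bt.gTwo := by
  have hp := b.norm_pZero hcross
  -- `Ref g₂ ⟂ f̃₀, f̃₁`
  have h0 : ⟪bt.fZero, refl b.pZero b.gTwo⟫ = 0 := by
    rw [ht.fZero_eq hcross hcrosst, inner_neg_left, inner_refl_refl hp, real_inner_comm, inner_gTwo_fZero, neg_zero]
  have h1 : ⟪bt.fOne, refl b.pZero b.gTwo⟫ = 0 := by
    rw [ht.fOne_eq hcross hcrosst, inner_neg_left, inner_refl_refl hp, real_inner_comm, inner_gTwo_fOne, neg_zero]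
  rw [EuclideanSpace.inner_eq_star_dotProduct, star_trivial, dotProduct_comm] at h0 h1
  obtain ⟨μ, hμ⟩ := exists_eq_smul_cross (bt.cross_ne_zero hcrosst) h0 h1
  refine ⟨μ, fun hμ0 ↦ ?_, ?_⟩
  · rw [hμ0, zero_smul] at hμ
    have : refl b.pZero b.gTwo = 0 := (WithLp.ofLp_eq_zero 2).1 hμ
    exact b.gTwo_ne_zero hcross (refl_injective hp (by rw [this, map_zero]))
  · apply (WithLp.ofLp_injective 2)
    rw [hμ, WithLp.ofLp_smul, gTwo, WithLp.ofLp_toLp]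

/-- **The frame ratio** `μ` with `Ref g₂ = μ g̃₂` (chosen). [folklore] -/
def mu : ℝ := (ht.exists_refl_gTwo hcross hcrosst).choose

/-- The frame ratio is nonzero. [folklore] -/
theorem mu_ne_zero : ht.mu hcross hcrosst ≠ 0 := (ht.exists_refl_gTwo hcross hcrosst).choose_spec.1

/-- `Ref g₂ = μ g̃₂`. [folklore] -/
theorem refl_gTwo : refl b.pZero b.gTwo = ht.mu hcross hcrosst • bt.gTwo := (ht.exists_refl_gTwo hcross hcrosst).choose_spec.2

/-- **The frame relation**: `Ref (frame Z) = framẽ (-Z₀, -Z₁, μ Z₂)`. [folklore] -/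
theorem refl_frame (Z : 𝔼 3) :
    refl b.pZero (b.frame hcross Z) = bt.frame hcrosst (pt3 (-Z 0) (-Z 1) (ht.mu hcross hcrosst * Z 2)) := by
  have e0 : (pt3 (-Z 0) (-Z 1) (ht.mu hcross hcrosst * Z 2) : 𝔼 3) 0 = -Z 0 := rfl
  have e1 : (pt3 (-Z 0) (-Z 1) (ht.mu hcross hcrosst * Z 2) : 𝔼 3) 1 = -Z 1 := rfl
  have e2 : (pt3 (-Z 0) (-Z 1) (ht.mu hcross hcrosst * Z 2) : 𝔼 3) 2 = ht.mu hcross hcrosst * Z 2 := rfl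
  rw [frame_apply, frame_apply, e0, e1, e2, map_add, map_add, map_smul, map_smul, map_smul, ht.refl_gTwo hcross hcrosst,
    ht.fZero_eq hcross hcrosst, ht.fOne_eq hcross hcrosst, smul_neg, smul_neg, neg_smul, neg_smul, neg_neg, neg_neg, smul_smul,
    mul_comm (Z 2)]

/-- **The transported blow-up of a reflected chart vector, to first order**: for `y = blowDown Z`
(so `y - pZero = κ frame Z`), `blowUp̃ (pZero + Ref (y - pZero)) = (-Z₀, -Z₁, μ Z₂)`. [folklore] -/
theorem blowUp_pZero_add_refl {κ : ℝ} (hκ : κ ≠ 0) (Z : 𝔼 3) :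
    bt.blowUp hcrosst κ (b.pZero + refl b.pZero (b.blowDown hcross κ Z - b.pZero)) =
      pt3 (-Z 0) (-Z 1) (ht.mu hcross hcrosst * Z 2) := by
  rw [blowDown, add_sub_cancel_left, map_smul, ht.refl_frame hcross hcrosst, blowUp, ht.pZero_eq (hcross := hcross) (hcrosst := hcrosst),
    add_sub_cancel_left, map_smul, smul_smul, inv_mul_cancel₀ hκ, one_smul, ContinuousLinearEquiv.symm_apply_apply]

/-- **The transported blow-up of an inverted point, with error**: for `‖Z‖ ≤ Zmax` and `κ` small the
blow-up coordinates of `sphereInv (blowDown Z)` for `b̃` are within `ε` of `(-Z₀, -Z₁, μ Z₂)`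
(differentiability of the inversion at `pZero`). [folklore] -/
theorem exists_blowUp_sphereInv_near {Zmax ε : ℝ} (hZ : 0 < Zmax) (hε : 0 < ε) :
    ∃ κ₁ > 0, ∀ κ, 0 < κ → κ ≤ κ₁ → ∀ Z : 𝔼 3, ‖Z‖ ≤ Zmax →
      ‖bt.blowUp hcrosst κ (sphereInv (b.blowDown hcross κ Z)) - pt3 (-Z 0) (-Z 1) (ht.mu hcross hcrosst * Z 2)‖ ≤ ε := by
  have hp := b.norm_pZero hcross
  set NF := ‖((b.frame hcross : (𝔼 3) ≃L[ℝ] 𝔼 3) : (𝔼 3) →L[ℝ] 𝔼 3)‖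
  set NG := ‖(((bt.frame hcrosst).symm : (𝔼 3) ≃L[ℝ] 𝔼 3) : (𝔼 3) →L[ℝ] 𝔼 3)‖
  have hNF : 0 ≤ NF := norm_nonneg _
  have hNG : 0 ≤ NG := norm_nonneg _
  -- little-o form of the derivative of `sphereInv` at `pZero`
  have hder := hasFDerivAt_sphereInv_refl hp
  rw [hasFDerivAt_iff_isLittleO_nhds_zero] at hder
  have hc : 0 < ε / ((NG + 1) * (NF + 1) * Zmax) := by positivity
  obtain ⟨δ, hδ, hδb⟩ := Metric.eventually_nhds_iff.1 (hder.def hc)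
  refine ⟨δ / (2 * (NF + 1) * Zmax), by positivity, fun κ hκ hκ1 Z hZle ↦ ?_⟩
  set h : 𝔼 3 := κ • b.frame hcross Z with hh
  have hy : b.blowDown hcross κ Z = b.pZero + h := rfl
  have hnh : ‖h‖ ≤ κ * NF * Zmax := by
    rw [hh, norm_smul, Real.norm_eq_abs, abs_of_pos hκ, mul_assoc]
    refine mul_le_mul_of_nonneg_left ?_ hκ.le
    have h1 : ‖b.frame hcross Z‖ ≤ NF * ‖Z‖ := ((b.frame hcross : (𝔼 3) ≃L[ℝ] 𝔼 3) : (𝔼 3) →L[ℝ] 𝔼 3).le_opNorm Z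
    exact h1.trans (mul_le_mul_of_nonneg_left hZle hNF)
  have hnh' : ‖h‖ < δ := by
    have h1 : κ * NF * Zmax ≤ δ / (2 * (NF + 1) * Zmax) * NF * Zmax := by gcongr
    have h2 : δ / (2 * (NF + 1) * Zmax) * NF * Zmax < δ := by
      have : δ / (2 * (NF + 1) * Zmax) * NF * Zmax = δ * (NF / (2 * (NF + 1))) := by field_simp
      rw [this]
      have : NF / (2 * (NF + 1)) < 1 := (div_lt_one (by positivity)).2 (by linarith)
      nlinarith
    linarith
  have hE := hδb (show dist h 0 < δ by rwa [dist_zero_right])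
  -- `sphereInv (p + h) = p + Ref h + E`, `‖E‖ ≤ c ‖h‖`
  set E := sphereInv (b.pZero + h) - sphereInv b.pZero - refl b.pZero h with hEdef
  have hsph : sphereInv (b.blowDown hcross κ Z) = (b.pZero + refl b.pZero (b.blowDown hcross κ Z - b.pZero)) + E := by
    rw [hy, hEdef, sphereInv_of_norm_eq_two hp, add_sub_cancel_left]; abel
  have hlin : bt.blowUp hcrosst κ (sphereInv (b.blowDown hcross κ Z)) =
      pt3 (-Z 0) (-Z 1) (ht.mu hcross hcrosst * Z 2) + κ⁻¹ • (bt.frame hcrosst).symm E := by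
    rw [hsph, ← ht.blowUp_pZero_add_refl hcross hcrosst hκ.ne' Z, blowUp, blowUp]
    rw [show b.pZero + refl b.pZero (b.blowDown hcross κ Z - b.pZero) + E - bt.pZero =
      (b.pZero + refl b.pZero (b.blowDown hcross κ Z - b.pZero) - bt.pZero) + E by abel, map_add, smul_add]
  rw [hlin, add_sub_cancel_left, norm_smul, norm_inv, Real.norm_eq_abs, abs_of_pos hκ]
  have h3 : ‖(bt.frame hcrosst).symm E‖ ≤ NG * ‖E‖ := (((bt.frame hcrosst).symm : (𝔼 3) ≃L[ℝ] 𝔼 3) : (𝔼 3) →L[ℝ] 𝔼 3).le_opNorm E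
  have h4 : ‖E‖ ≤ ε / ((NG + 1) * (NF + 1) * Zmax) * (κ * NF * Zmax) := hE.trans (mul_le_mul_of_nonneg_left hnh hc.le)
  have h5 : κ⁻¹ * ‖(bt.frame hcrosst).symm E‖ ≤ κ⁻¹ * (NG * (ε / ((NG + 1) * (NF + 1) * Zmax) * (κ * NF * Zmax))) := by
    gcongr; exact h3.trans (mul_le_mul_of_nonneg_left h4 hNG)
  have h6 : κ⁻¹ * (NG * (ε / ((NG + 1) * (NF + 1) * Zmax) * (κ * NF * Zmax))) = ε * (NG / (NG + 1)) * (NF / (NF + 1)) := by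
    field_simp
  have h7 : NG / (NG + 1) ≤ 1 := (div_le_one (by positivity)).2 (by linarith)
  have h8 : NF / (NF + 1) ≤ 1 := (div_le_one (by positivity)).2 (by linarith)
  have h9 : ε * (NG / (NG + 1)) * (NF / (NF + 1)) ≤ ε * (NG / (NG + 1)) * 1 :=
    mul_le_mul_of_nonneg_left h8 (by positivity)
  have h10 : ε * (NG / (NG + 1)) ≤ ε * 1 := mul_le_mul_of_nonneg_left h7 hε.le
  linarith

end Frame

end IsTransport

end BandData

end Literature.Topology.FourManifolds
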